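/-
Origin: expansion seat `prover-pub-hodgecm-mc-binder-2-g19-0`, handover #103 2026-08-21T01:29Z md5 458ec0c9a187 (NEW; 153 l.; ns HodgeCM.Model.LiuIndex (§0) + HodgeCM.Model.SplitLineE (§1) + HodgeCM.Model (§2); §0 reducible **LiuIndex.repAt a₀ q := if q = ⟦a₀⟧ then a₀ else Quotient.out q** (classical if; the POINTED representative choice — theta-3-g28's #S15 r2 ∕ #S16 r2 take a representative SECTION ρ as parameter and instantiate it at repAt) + repAt_mk_self ∕ repAt_spec (⟦repAt a₀ q⟧ = q) ∕ repAt_of_ne ∕ repAt_injective; §1 SplitLineE.exists_ofCM_eq_of_eq (index lines of record over EQUAL scalar families are equal records for a transported splitting — subst, no Weil-module transport); §2 **mem_biSup_block_pin_of_line_eq** ∕ _of_eq_line (the hJS block clause at the pin from the theta side's own model over ANY record p PROPOSITIONALLY EQUAL to an index line line j: subst + #102 mem_biSup_block_pin_of_mem_iSup_range — consumers: theta-3's LiuIndex.exists_line_eq_ofCM gives line j = splitLine_k, sinst-1's dictEquivOne ∕ dictEquivZeroCanonical give the A-surjection), exists_isometric_of_line_eq (slot clause along the record equality, z := 1). CERT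 lane farm lean-direct over PKG RUN-67 oleans + binder-2 #99–#102 oleans built from the kit sources: rc 0 ∕ 41 s ∕ 0 warn ∕ 0 proof holes; #print axioms 8 ∕ 8 ⊆ {propext, Classical.choice, Quot.sound}, proof-holeAx 0 (g19∕farm∕logs∕ax_pineq.log db51601feb26); FQN 0 hits vs headline-decls + PKG + stage68∕69∕70 dirs of all lanes (theta-3's LiuIndex names rep ∕ rep_injective ∕ rep_mk_equiv disjoint). NAME LIST (theorems): HodgeCM.Model.LiuIndex.repAt_spec · HodgeCM.Model.LiuIndex.repAt_injective · HodgeCM.Model.mem_biSup_block_pin_of_line_eq. (`HOME/mc/pub-hodgecm-mc-binder-2/g19/stage70/HodgeCM/Model/LiuDictionaryPinEq.lean`, md5 458ec0c9a187, 153 lines);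
landed by the second packager p2 gen 17 (p2-g17) in gate run 70 as `HodgeCM/Model/LiuDictionaryPinEq.lean` (verbatim).
-/
/-
Origin: BINDER seat `prover-pub-hodgecm-mc-binder-2-g19-0` (unit pub-hodgecm-mc-binder-2-g19, gen 19 of mc-binder-2), 2026-08-21.
Target in PKG: `HodgeCM/Model/LiuDictionaryPinEq.lean` (NEW additive KERNEL leaf beside E; imports binder-2 #102 `Model/LiuDictionaryPin`
(RUN 69) only; nothing imports it; outside E's import closure; MODEL-N ±0).
KERNEL ONLY: 1 reducible abbreviation (`repAt`, a POINTED choice of class representatives) + theorems; 0 records, nothing cited,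
0 `def … : Prop`. Nothing here is a claim of the manuscripts under adjudication.
-/
import Summits.HodgeConjecture.HodgeCM.Model.LiuDictionaryPin

set_option autoImplicit false

/-!
# (J3) The pin's block clause ALONG AN EQUALITY OF INDEX RECORDS — dissolving the W-isometry transport

SEAM (binder-2-g19 STATUS 2026-08-21T01:24:57Z): theta-3's index (#S15 `Model/LiuIndexPin.lean`) lists ONE split line per isometry class
of Gram scalars, at the representative `rep q := Quotient.out q`; the honest slot records (sinst-1 #1254 `splitLineZero ∕ One`, = #102's
`SplitLineE.ofCMOf V e₁ (lineVec L (c.D.a k)) …`) carry the LITERAL slot scalar `a_k := c.D.a k`, in general `≠ rep ⟦a_k⟧ = z z̄ a_k`.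
Feeding the slot's isotypic membership (sinst-1 `dictEquiv*`) into the pin's `⨆ j ∈ T, block j` through #101 ∕ #102 would then need the
ISOMETRY TRANSPORT of Weil central coinvariants along `w ↦ z w` — a non-polarisation-preserving intertwiner the tree does not have.
This leaf types the CHEAP way round it:

* `mem_biSup_block_pin_of_line_eq` — the block clause at the pin from the theta side's model over ANY record `p` PROPOSITIONALLY EQUAL to
  an index line `line j` (`subst` + #102 `mem_biSup_block_pin_of_mem_iSup_range`): no module transport, only `Eq` of records;
* `SplitLineE.exists_ofCM_eq_of_eq` — index lines of record over EQUAL scalar families are equal records for a transported splitting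
  (`subst`), so an enumeration whose representative AT the class of the slot scalar IS the slot scalar contains the honest slot record
  up to `Eq`;
* `LiuIndex.repAt a₀ q` (reducible) — the POINTED representative choice `if q = ⟦a₀⟧ then a₀ else Quotient.out q` pattern, as a plain
  function on any quotient with `repAt_mk_self : repAt a₀ ⟦a₀⟧ = a₀` and `repAt_spec : ⟦repAt a₀ q⟧ = q`; pointing the theta lane's
  enumeration at `a₀ := c.D.a i` (one enumeration per `(V, c, i)`, each a transversal — the cited Prop. 4.13 ∕ Thm. 4.18 (2) hold for EVERY
  transversal, so `hcite` may be demanded per `(V, c, i)` without changing its kind) makes the slot-`i` record an index line ON THE NOSE.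
Nothing is asserted about any instance.
-/

noncomputable section

open Function Set
open NumberField
open Literature.AlgebraicGeometry.Motives
open Literature.AlgebraicGeometry.ShimuraVarieties
open Literature.AlgebraicGeometry.HodgeTheory
open Literature.NumberTheory.Automorphic
open Literature.NumberTheory.Automorphic.PicardCM
open Literature.NumberTheory.Weil1964
open Literature.NumberTheory.GelbartRogawski1991 Literature.NumberTheory.GelbartRogawski1991.UnitaryDualPair
open Literature.NumberTheory.Transcendental (Arapura2012_Cor_15_4_6)

/-! ## §0. Pointed representatives of a quotient -/

namespace HodgeCM.Model.LiuIndex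

universe u

variable {α : Type u} {r : Setoid α}

attribute [local instance] Classical.propDecidable

/-- **the representative choice POINTED AT `a₀`**: the class of `a₀` is represented by `a₀` itself, every other class by `Quotient.out`.
[folklore] -/
abbrev repAt (a₀ : α) (q : Quotient r) : α :=
  if q = Quotient.mk r a₀ then a₀ else q.out

/-- (Ported verbatim from the HodgeCMPerL package; no docstring in the source.) -/
theorem repAt_mk_self (a₀ : α) : repAt a₀ (Quotient.mk r a₀) = a₀ := if_pos rfl

/-- (Ported verbatim from the HodgeCMPerL package; no docstring in the source.) -/
theorem repAt_spec (a₀ : α) (q : Quotient r) : Quotient.mk r (repAt a₀ q) = q := by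
  by_cases h : q = Quotient.mk r a₀
  · rw [repAt, if_pos h, h]
  · rw [repAt, if_neg h, q.out_eq]

/-- (Ported verbatim from the HodgeCMPerL package; no docstring in the source.) -/
theorem repAt_of_ne (a₀ : α) {q : Quotient r} (h : q ≠ Quotient.mk r a₀) : repAt a₀ q = q.out := if_neg h

/-- a pointed representative choice is injective on classes (as every section of `Quotient.mk` is). [folklore] -/
theorem repAt_injective (a₀ : α) : Injective (repAt (r := r) a₀) := fun q q' h => by
  rw [← repAt_spec a₀ q, ← repAt_spec a₀ q', h]

end HodgeCM.Model.LiuIndex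

namespace HodgeCM.Model

open HodgeCM.Model.TowerLevel HodgeCM.Model.TowerCarrier HodgeCM.Literature.Theta HodgeCM.Literature.Theta.LiuAlbaneseModuleDatum
open HodgeCM.CMTypeOps (inflate)
open HodgeCM.Universe (ThetaModel)

variable {L : CMField} {ι₁ : (L : Type) →+* ℂ}

/-! ## §1. Index lines of record over equal scalar families -/

namespace SplitLineE

variable (V : HermSpace3 L ι₁) {n : ℕ} (e : Fin 3 × Fin 1 ≃ Fin n)

/-- **index lines of record over EQUAL scalar families are EQUAL records** (for the splitting transported along the equality):
if `dW = dW'` then every `ofCM V e dW … s hs` IS `ofCM V e dW' … s' hs'` for some `(s', hs')` — by `subst`, no Weil-module transport.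
[folklore] -/
theorem exists_ofCM_eq_of_eq {dW dW' : Fin 1 → (L : Type)} (h : dW = dW')
    (hdW : ∀ i, IsCMField.complexConj (L : Type) (dW i) = dW i) (hdW0 : ∀ i, dW i ≠ 0)
    (hdW' : ∀ i, IsCMField.complexConj (L : Type) (dW' i) = dW' i) (hdW0' : ∀ i, dW' i ≠ 0)
    (s : UnitaryGroup.adelicPair (↥(maximalRealSubfield (L : Type))) (L : Type) (IsCMField.complexConj (L : Type)) 3 1
        (Matrix.diagonal (frameD V)) (Matrix.diagonal dW) →*
      adelicMpCont (↥(maximalRealSubfield (L : Type))) (Fin n)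
        (adelicGram (↥(maximalRealSubfield (L : Type))) e (realDiagonal (L : Type) (frameD V) (frameD_real V))
          (realDiagonal (L : Type) dW hdW)))
    (hs : (cmSplittingDatum (L : Type) e (frameD V) (frameD_real V) (frameD_ne V) dW hdW hdW0).IsCompatible s) :
    ∃ (s' : UnitaryGroup.adelicPair (↥(maximalRealSubfield (L : Type))) (L : Type) (IsCMField.complexConj (L : Type)) 3 1
          (Matrix.diagonal (frameD V)) (Matrix.diagonal dW') →*
        adelicMpCont (↥(maximalRealSubfield (L : Type))) (Fin n)
          (adelicGram (↥(maximalRealSubfield (L : Type))) e (realDiagonal (L : Type) (frameD V) (frameD_real V))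
            (realDiagonal (L : Type) dW' hdW')))
      (hs' : (cmSplittingDatum (L : Type) e (frameD V) (frameD_real V) (frameD_ne V) dW' hdW' hdW0').IsCompatible s'),
      ofCM V e dW' hdW' hdW0' s' hs' = ofCM V e dW hdW hdW0 s hs := by
  subst h
  exact ⟨s, hs, rfl⟩

end SplitLineE

/-! ## §2. The block clause at the pin along an equality of records -/

variable (hHD : exists_isReal_hodgeModel) (hI : hodgePQ_independent_of_hodgeModel)
  (h₁ : BallQuotientUniformised) (h₃ : CMAbelianVarietyRealised) (hA : Arapura2012_Cor_15_4_6)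
variable (V : HermSpace3 L ι₁) (I : Type) (line : I → SplitLineE V)

/-- **THE `hJS` BLOCK CLAUSE AT THE PIN, ALONG AN EQUALITY OF INDEX RECORDS**: if the index line `line j` (`j ∈ S`) is PROPOSITIONALLY
EQUAL to a record `p` (e.g. sinst-1's `splitLineZeroTwisted` ∕ `splitLineOne` at a pointed enumeration), then a tower vector in the
isotypic sum of any `ℂ[U(V)(𝔸_f)]`-quotient `M` of `Ω(p, χ)`, `χ` automorphic on `p`, lies in `⨆ j ∈ S, block j` of the pinned dictionary —
no transport of Weil modules, only `subst`. [folklore] -/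
theorem mem_biSup_block_pin_of_line_eq {M : Type*} [AddCommGroup M] [Module (adelicAlgebra V) M]
    {S : Finset I} {j : I} (hj : j ∈ S) {p : SplitLineE V} (hp : line j = p)
    {χ : p.CharW} (hχ : p.IsAutChar χ) (φ : p.Ω (ιVE V) χ →ₗ[adelicAlgebra V] M) (hφ : Surjective φ)
    {x : Tower hHD hI (ballQuotientUniformisedDatum_of h₁) h₃ hA V}
    (hx : x ∈ ⨆ ψ : M →ₗ[adelicAlgebra V] Tower hHD hI (ballQuotientUniformisedDatum_of h₁) h₃ hA V,
      (LinearMap.range ψ).restrictScalars ℂ) :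
    (x : (liuDictionaryPin hHD hI h₁ h₃ hA V I line).H) ∈ ⨆ j ∈ S, (liuDictionaryPin hHD hI h₁ h₃ hA V I line).block j := by
  subst hp
  exact mem_biSup_block_pin_of_mem_iSup_range hHD hI h₁ h₃ hA V I line hj hχ φ hφ hx

/-- the same with the equality the other way round. [folklore] -/
theorem mem_biSup_block_pin_of_eq_line {M : Type*} [AddCommGroup M] [Module (adelicAlgebra V) M]
    {S : Finset I} {j : I} (hj : j ∈ S) {p : SplitLineE V} (hp : p = line j)
    {χ : p.CharW} (hχ : p.IsAutChar χ) (φ : p.Ω (ιVE V) χ →ₗ[adelicAlgebra V] M) (hφ : Surjective φ)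
    {x : Tower hHD hI (ballQuotientUniformisedDatum_of h₁) h₃ hA V}
    (hx : x ∈ ⨆ ψ : M →ₗ[adelicAlgebra V] Tower hHD hI (ballQuotientUniformisedDatum_of h₁) h₃ hA V,
      (LinearMap.range ψ).restrictScalars ℂ) :
    (x : (liuDictionaryPin hHD hI h₁ h₃ hA V I line).H) ∈ ⨆ j ∈ S, (liuDictionaryPin hHD hI h₁ h₃ hA V I line).block j :=
  mem_biSup_block_pin_of_line_eq hHD hI h₁ h₃ hA V I line hj hp.symm hχ φ hφ hx

/-- **the slot clause along an equality of records**: if `line j = p` and `p.scalar = a_i`, the isometry clause holds with `z := 1`.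
[folklore] -/
theorem exists_isometric_of_line_eq {j : I} {p : SplitLineE V} (hp : line j = p) {a : (L : Type)} (ha : p.scalar = a) :
    ∃ z : (L : Type), z ≠ 0 ∧ (line j).scalar = z * conjRingHomK L z * a :=
  exists_isometric_of_scalar_eq (by rw [hp, ha])

end HodgeCM.Model

end
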